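import Summits.RiemannHypothesis.RiemannHypothesis.Theorems.PfPersistenceM2Mollified
import Summits.RiemannHypothesis.RiemannHypothesis.Theorems.PfPersistenceM2WindowSum
import HarnessLib

/-!
# M2 upper half (5/7): the window criterion in Rayleigh form and the mollifier at the zeros

pub-rhpf cell (M2 seat, generation 3) — part 5 of 7 of the M2 UPPER-HALF packet.  HONEST FRAMING:
long-odds MECHANISM SEARCH; no RH claims.  Everything in this file is PROVED (kernel-checked, RH-free) or an
explicitly named `def … : Prop` taken as an argument; nothing here implies or assumes RH.  The packet's
headline and full ledger are in `PfPersistenceM2UpperLeak.lean` (part 7):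
`ProlateLeakL1 A p Λ` (ONE RH-free prolate leak bound, exponent `p`) + two named literature facts
⇒ `ConnesLawUpperWitnessWith (2p + 1 + δ)` ⇒ `ConnesLawUpperWith (2p + 1 + δ)` ⇒ `ConnesLawUpper`.

This part (PROVED): `exists_re_weilQuadratic_le_of_windowBound` — `Re W(k) ≤ C·X·‖k‖₂²` for any Weil test
function with a window-indexed zero bound whose `log`-weighted partial sums are `≤ X ‖k‖₂²` (explicit
formula `re_weilQuadratic_le_of_zeroSum_le` + the sharp count of part 1), its energy form
`exists_weilGroundEnergy_le_of_windowBound`, the window-indexed mollifier bound at a zero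
`norm_weilMellin_moll_le_min` (`‖φ̂_n(ρ)‖ ≤ e^{1/2} min(1, 4C(n+1)/(j+1))`), and the statement of the norm
floor `LeakWitnessNormFloor` (proved in part 7).
-/

noncomputable section

set_option linter.dupNamespace false  -- the mandated namespace repeats `RiemannHypothesis`

open Complex Filter Set Topology Metric MeasureTheory
open Literature.NumberTheory.LFunctions
open scoped ComplexConjugate Convolution

namespace Summit.RiemannHypothesis.RiemannHypothesis.Theorems.PfPersistenceM2Leak

/-! ## §I The assembly: (H-LEAK-L1) ⇒ `ConnesLawUpperWith (2p + 1 + δ)` -/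

section Assembly

open WeilContinuous

/-- **`L²` floor of the mollified witness (PROVED below from Fact 6.4, `leakWitnessNormFloor_of_tendsto`).**
For integer `N = λ² ≥ Λ'`, every prolate pair and every mollifier index `n`:
`c ≤ (log N + 2) · ‖k₀ ⋆ φ_n‖₂²`.  Source: `k̂(½) = M_λ(0)·φ̂_n(½) = M_λ(0)`, `|4M_λ(0) − ξ(½)| ≤ ε`
(Fact 6.4 = `prolateGuess_tendsto_riemannXi` at `α₀ = 0`), `ξ(½) ≠ 0` (`riemannXi_one_half_ne_zero`), and
Cauchy–Schwarz on the support of length `≤ log N + 2`. -/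
def LeakWitnessNormFloor (Λ' c : ℝ) : Prop :=
  0 < c ∧ ∀ N : ℕ, Λ' ≤ (N : ℝ) → ∀ f0 f4 : ℝ → ℝ,
    IsProlateFunction (Real.sqrt N) 0 f0 → IsProlateFunction (Real.sqrt N) 4 f4 → ∀ n : ℕ,
      c ≤ (Real.log N + 2) * ∫ t : ℝ, ‖leakWitness (Real.sqrt N) f0 f4 n t‖ ^ 2

/-- Rayleigh form of the window criterion: `Re W(k) ≤ C · X · ‖k‖₂²` whenever the Weil test function `k`
has a window-indexed zero bound `‖k̂(ρ)‖² ≤ w(j(ρ))` with partial sums `Σ_{j<M} log(j+2) w(j) ≤ X ‖k‖₂²`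
(explicit formula `re_weilQuadratic_le_of_zeroSum_le` + the sharp count `exists_windowCount`). -/
theorem exists_re_weilQuadratic_le_of_windowBound :
    ∃ C : ℝ, 0 < C ∧ ∀ (X : ℝ) (k : ℝ → ℂ) (w : ℕ → ℝ), IsWeilTest k → (∀ j, 0 ≤ w j) →
      (∀ ρ ∈ ZetaZeros.riemannZetaNontrivialZeros, ‖weilMellin k ρ‖ ^ 2 ≤ w (windowIndex ρ)) →
      (∀ M : ℕ, ∑ j ∈ Finset.range M, Real.log ((j : ℝ) + 2) * w j ≤ X * ∫ t : ℝ, ‖k t‖ ^ 2) →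
      (weilQuadratic k).re ≤ C * X * ∫ t : ℝ, ‖k t‖ ^ 2 := by
  classical
  obtain ⟨C, hC0, hC⟩ := exists_windowCount
  refine ⟨C, hC0, fun X k w hk hw hρ hsum ↦ ?_⟩
  refine re_weilQuadratic_le_of_zeroSum_le hk fun T ↦ ?_
  rw [finsum_weilZeroIndex_eq_sum (fun ρ ↦ (riemannZetaZeroOrder ρ : ℝ) * ‖weilMellin k ρ‖ ^ 2)]
  set F : Finset ℂ := (weilZeroFinset T).map (Function.Embedding.subtype _) with hFdef
  have hF : ∀ ρ ∈ F, ρ ∈ ZetaZeros.riemannZetaNontrivialZeros := fun ρ hρ ↦ by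
    rw [hFdef, Finset.mem_map] at hρ
    obtain ⟨z, -, rfl⟩ := hρ
    exact z.2
  have e : ∑ ρ ∈ weilZeroFinset T, (riemannZetaZeroOrder (ρ : ℂ) : ℝ) * ‖weilMellin k ρ‖ ^ 2 =
      ∑ ρ ∈ F, (riemannZetaZeroOrder ρ : ℝ) * ‖weilMellin k ρ‖ ^ 2 := by
    rw [hFdef, Finset.sum_map]; rfl
  rw [e]
  calc ∑ ρ ∈ F, (riemannZetaZeroOrder ρ : ℝ) * ‖weilMellin k ρ‖ ^ 2
      ≤ ∑ ρ ∈ F, (riemannZetaZeroOrder ρ : ℝ) * w (windowIndex ρ) := by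
        refine Finset.sum_le_sum fun ρ hρ' ↦ ?_
        exact mul_le_mul_of_nonneg_left (hρ ρ (hF ρ hρ'))
          (riemannZetaZeroOrder_nonneg_of_zero (ZetaZeros.riemannZetaNontrivialZeros.zeta_eq_zero (hF ρ hρ')))
    _ ≤ C * ∑ j ∈ Finset.range (F.sup windowIndex + 1), Real.log ((j : ℝ) + 2) * w j := hC w hw F hF
    _ ≤ C * (X * ∫ t : ℝ, ‖k t‖ ^ 2) := mul_le_mul_of_nonneg_left (hsum _) hC0.le
    _ = C * X * ∫ t : ℝ, ‖k t‖ ^ 2 := by ring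

/-- Pointwise-in-`a` form of the window criterion: `ε(a) ≤ C · X` whenever some test in the window has a
window-indexed zero bound with partial sums `≤ X ‖k‖²`. -/
theorem exists_weilGroundEnergy_le_of_windowBound :
    ∃ C : ℝ, 0 < C ∧ ∀ (a X : ℝ) (k : ℝ → ℂ) (w : ℕ → ℝ), IsWeilTest k →
      tsupport k ⊆ Icc (-a) a → 0 < ∫ t : ℝ, ‖k t‖ ^ 2 → (∀ j, 0 ≤ w j) →
      (∀ ρ ∈ ZetaZeros.riemannZetaNontrivialZeros, ‖weilMellin k ρ‖ ^ 2 ≤ w (windowIndex ρ)) →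
      (∀ M : ℕ, ∑ j ∈ Finset.range M, Real.log ((j : ℝ) + 2) * w j ≤ X * ∫ t : ℝ, ‖k t‖ ^ 2) →
      weilGroundEnergy a ≤ C * X := by
  obtain ⟨C, hC0, hC⟩ := exists_re_weilQuadratic_le_of_windowBound
  refine ⟨C, hC0, fun a X k w hk hs hpos hw hρ hsum ↦ ?_⟩
  refine (weilGroundEnergy_le_div hk hs hpos).trans ?_
  rw [div_le_iff₀ hpos]
  exact hC X k w hk hw hρ hsum

/-- The mollifier bound at a non-trivial zero, window-indexed:
`‖φ̂_n(ρ)‖ ≤ e^{1/2} · min(1, 4C(n+1)/(j+1))`, `j = windowIndex ρ`, given the decay with constant `C ≥ 1`. -/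
theorem norm_weilMellin_moll_le_min {C : ℝ} (hC1 : 1 ≤ C)
    (hC : ∀ (n : ℕ) (s : ℂ), ‖weilMellin (moll n) s‖ * ‖s - 1 / 2‖ ≤
      C * ((n : ℝ) + 1) * Real.exp (|s.re - 1 / 2| / ((n : ℝ) + 1)))
    (n : ℕ) {ρ : ℂ} (hρ : ρ ∈ ZetaZeros.riemannZetaNontrivialZeros) :
    ‖weilMellin (moll n) ρ‖ ≤
      Real.exp (1 / 2) * min 1 (4 * C * ((n : ℝ) + 1) / ((windowIndex ρ : ℝ) + 1)) := by
  have hre0 := ZetaZeros.riemannZetaNontrivialZeros.re_pos hρ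
  have hre1 := ZetaZeros.riemannZetaNontrivialZeros.re_lt_one hρ
  have habs : |ρ.re - 1 / 2| ≤ 1 / 2 := abs_le.2 ⟨by linarith, by linarith⟩
  have hK : (1 : ℝ) ≤ (n : ℝ) + 1 := by linarith [n.cast_nonneg (α := ℝ)]
  have hK0 : (0 : ℝ) < (n : ℝ) + 1 := by linarith
  -- (i) the trivial bound
  have h1 : ‖weilMellin (moll n) ρ‖ ≤ Real.exp (1 / 2) :=
    (norm_weilMellin_moll_le n ρ).trans (Real.exp_le_exp.2 habs)
  set j := windowIndex ρ with hj
  have hj0 : (0 : ℝ) < (j : ℝ) + 1 := by positivity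
  rcases le_or_gt 1 (4 * C * ((n : ℝ) + 1) / ((j : ℝ) + 1)) with hcase | hcase
  · rw [min_eq_left hcase, mul_one]; exact h1
  · rw [min_eq_right hcase.le]
    -- then `j ≥ 1`, so `|γ| ≥ (j+1)/4`
    have hj1 : (1 : ℝ) ≤ j := by
      by_contra hlt
      have hj0' : j = 0 := by
        have : (j : ℝ) < 1 := not_le.1 hlt
        exact_mod_cast (show (j : ℕ) < 1 by exact_mod_cast this) |> Nat.lt_one_iff.1
      rw [hj0', Nat.cast_zero, zero_add, div_one] at hcase
      nlinarith
    have hγ : ((j : ℝ) + 1) / 4 ≤ |ρ.im| := by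
      have := windowIndex_le ρ
      rw [← hj] at this
      linarith
    have hγ0 : 0 < |ρ.im| := lt_of_lt_of_le (by positivity) hγ
    have hnorm : |ρ.im| ≤ ‖ρ - 1 / 2‖ := by
      have : (ρ - 1 / 2).im = ρ.im := by simp
      rw [← this]; exact Complex.abs_im_le_norm _
    have hn0 : 0 < ‖ρ - 1 / 2‖ := hγ0.trans_le hnorm
    have h2 := hC n ρ
    have hexp : Real.exp (|ρ.re - 1 / 2| / ((n : ℝ) + 1)) ≤ Real.exp (1 / 2) :=
      Real.exp_le_exp.2 ((div_le_self (abs_nonneg _) hK).trans habs)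
    have h3 : ‖weilMellin (moll n) ρ‖ * ‖ρ - 1 / 2‖ ≤ C * ((n : ℝ) + 1) * Real.exp (1 / 2) :=
      h2.trans (mul_le_mul_of_nonneg_left hexp (by positivity))
    rw [← le_div_iff₀ hn0] at h3
    refine h3.trans ?_
    rw [div_le_iff₀ hn0]
    calc C * ((n : ℝ) + 1) * Real.exp (1 / 2)
        = Real.exp (1 / 2) * (4 * C * ((n : ℝ) + 1) / ((j : ℝ) + 1)) * (((j : ℝ) + 1) / 4) := by
          field_simp
      _ ≤ Real.exp (1 / 2) * (4 * C * ((n : ℝ) + 1) / ((j : ℝ) + 1)) * ‖ρ - 1 / 2‖ :=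
          mul_le_mul_of_nonneg_left (hγ.trans hnorm) (by positivity)

end Assembly

end Summit.RiemannHypothesis.RiemannHypothesis.Theorems.PfPersistenceM2Leak
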